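import Mathlib.Analysis.Complex.AbsMax
import Mathlib.Analysis.Complex.CauchyIntegral
import Mathlib.Analysis.Analytic.IsolatedZeros
import Mathlib.Analysis.SpecialFunctions.Complex.Arg
import Mathlib.Analysis.SpecialFunctions.Trigonometric.Bounds
import HarnessLib

/-!
# Boundary uniqueness on an arc for functions holomorphic in the disc

Trunk T-STOCH support (complex analysis), an input of Carathéodory's extension theorem for
conformal maps onto Jordan domains (`Literature/Probability/RandomPlanarGeometry/ConformalMap.lean`,
`Literature.Probability.RandomPlanarGeometry.JordanDomain.exists_continuousOn_extension`: injectivity of the boundary correspondence).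

* `Complex.eqOn_zero_of_diffContOnCl_ball_of_eqOn_arc`: a function holomorphic in the unit disc
  and continuous on the closed disc which vanishes on an open arc of the unit circle
  (`sphere 0 1 ∩ U`, `U` open, meeting the circle) vanishes identically on the closed disc.
  Proof (the classical rotation trick): if the arc has angular half-width `ε > π / n`, the product
  `F z = ∏_{k < n} f (ω ^ k z)`, `ω = exp (2π i / n)`, is holomorphic in the disc, continuous on
  the closed disc and vanishes on the whole circle, hence `F ≡ 0` by the maximum modulus
  principle; by the isolated zeros principle one factor vanishes near `0`, so `f ≡ 0` by the
  identity theorem.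

This is the continuous case of the boundary uniqueness theorem of F. and M. Riesz–Privalov
(W. Rudin, *Real and Complex Analysis*, 3rd ed., Thm. 17.18, where vanishing a.e. on a set of
positive measure suffices for `H^p` functions); only the elementary case is needed and proved.

Mathlib has the ingredients (`Complex.norm_le_of_forall_mem_frontier_norm_le`,
`AnalyticAt.eventually_eq_zero_or_eventually_ne_zero`,
`AnalyticOnNhd.eqOn_zero_of_preconnected_of_eventuallyEq_zero`) but no boundary uniqueness
statement (searched `sphere.*eqOn`, `Privalov`, `Riesz`).

## References

* W. Rudin, *Real and Complex Analysis*, 3rd ed., McGraw-Hill (1987), Thm. 17.18.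
* Ch. Pommerenke, *Boundary Behaviour of Conformal Maps*, Springer (1992), Ch. 2 (use in
  Carathéodory's theorem).
-/

noncomputable section

open Filter Metric Set Topology Real

namespace Complex

/-- Points of an arithmetic progression of step `s ∈ (0, b - a)` meet the interval `(a, b)`:
for every `θ` there is an integer `j` with `θ + s * j ∈ Ioo a b`. [folklore] -/
theorem exists_int_add_mul_mem_Ioo {a b s : ℝ} (hs : 0 < s) (hab : s < b - a) (θ : ℝ) :
    ∃ j : ℤ, θ + s * j ∈ Ioo a b := by
  refine ⟨⌊(a - θ) / s⌋ + 1, ?_, ?_⟩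
  · have h1 : (a - θ) / s < (⌊(a - θ) / s⌋ : ℝ) + 1 := Int.lt_floor_add_one _
    rw [div_lt_iff₀ hs] at h1
    push_cast
    linarith
  · have h1 : (⌊(a - θ) / s⌋ : ℝ) ≤ (a - θ) / s := Int.floor_le _
    rw [le_div_iff₀ hs] at h1
    push_cast
    nlinarith

/-- A point of the unit circle is `exp (arg ζ * I)`. [folklore] -/
theorem exp_arg_mul_I_of_mem_sphere {ζ : ℂ} (hζ : ζ ∈ sphere (0 : ℂ) 1) :
    exp (arg ζ * I) = ζ := by
  have h := norm_mul_exp_arg_mul_I ζ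
  rw [mem_sphere_zero_iff_norm] at hζ
  rwa [hζ, ofReal_one, one_mul] at h

/-- Two points `exp (θ i)`, `exp (θ₀ i)` of the unit circle are at distance at most `|θ - θ₀|`.
[folklore] -/
theorem norm_exp_mul_I_sub_exp_mul_I_le (θ θ₀ : ℝ) :
    ‖exp (θ * I) - exp (θ₀ * I)‖ ≤ |θ - θ₀| := by
  have h : exp (θ * I) - exp (θ₀ * I) = exp (θ₀ * I) * (exp (I * (θ - θ₀ : ℝ)) - 1) := by
    rw [mul_sub, mul_one, ← exp_add]
    congr 2
    push_cast
    ring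
  rw [h, norm_mul, norm_exp_ofReal_mul_I, one_mul]
  simpa [Real.norm_eq_abs] using (norm_exp_I_mul_ofReal_sub_one_le (x := θ - θ₀))

/-- **Boundary uniqueness on an arc.** Let `f` be holomorphic in the unit disc and continuous on
the closed unit disc (`DiffContOnCl ℂ f (ball 0 1)`), and suppose `f = 0` on an open arc of the
unit circle: on `sphere 0 1 ∩ U` for an open set `U` meeting the circle. Then `f = 0` on the
closed unit disc. (Continuous case of the F. and M. Riesz–Privalov uniqueness theorem, Rudin,
*Real and Complex Analysis* (1987), Thm. 17.18; proved here by the rotation trick and the maximum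
modulus principle.) [folklore] -/
theorem eqOn_zero_of_diffContOnCl_ball_of_eqOn_arc {f : ℂ → ℂ} (hf : DiffContOnCl ℂ f (ball 0 1))
    {U : Set ℂ} (hU : IsOpen U) (hne : (sphere (0 : ℂ) 1 ∩ U).Nonempty)
    (h0 : ∀ z ∈ sphere (0 : ℂ) 1 ∩ U, f z = 0) :
    EqOn f 0 (closedBall (0 : ℂ) 1) := by
  classical
  -- an angular arc `|θ - θ₀| < ε` around `ζ₀ = exp (θ₀ i)` on which `f ∘ exp (· i)` vanishes
  obtain ⟨ζ₀, hζ₀S, hζ₀U⟩ := hne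
  obtain ⟨ε, hε, hball⟩ := Metric.isOpen_iff.1 hU ζ₀ hζ₀U
  set θ₀ : ℝ := arg ζ₀ with hθ₀
  have harc : ∀ θ : ℝ, |θ - θ₀| < ε → f (exp (θ * I)) = 0 := by
    intro θ hθ
    refine h0 _ ⟨by simp [norm_exp_ofReal_mul_I], hball ?_⟩
    rw [Metric.mem_ball, dist_eq_norm, ← exp_arg_mul_I_of_mem_sphere hζ₀S]
    exact (norm_exp_mul_I_sub_exp_mul_I_le θ θ₀).trans_lt hθ
  -- `n` rotations by `ω = exp (s i)`, `s = 2π / n < 2ε`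
  obtain ⟨n, hn⟩ := exists_nat_gt (π / ε)
  have hn0 : 0 < n := by
    rcases Nat.eq_zero_or_pos n with rfl | h
    · exact absurd hn (not_lt.2 (by simpa using (div_pos pi_pos hε).le))
    · exact h
  have hn0' : (0 : ℝ) < n := by exact_mod_cast hn0
  set s : ℝ := 2 * π / n with hs
  have hs0 : 0 < s := by positivity
  have hs2 : s < (θ₀ + ε) - (θ₀ - ε) := by
    have h1 : π / ε < n := hn
    rw [div_lt_iff₀ hε] at h1
    rw [hs, div_lt_iff₀ hn0']
    linarith
  have hsn : s * n = 2 * π := by rw [hs]; field_simp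
  set ω : ℂ := exp ((s : ℂ) * I) with hω
  have hω_norm : ‖ω‖ = 1 := by simp [hω, norm_exp_ofReal_mul_I]
  have hωk_norm : ∀ k : ℕ, ‖ω ^ k‖ = 1 := fun k ↦ by simp [norm_pow, hω_norm]
  have hωk_ne : ∀ k : ℕ, ω ^ k ≠ 0 := fun k ↦ by
    rw [← norm_ne_zero_iff, hωk_norm k]; exact one_ne_zero
  -- every point of the circle is rotated into the arc by some `ω ^ k`, `k < n`
  have hcover : ∀ ζ ∈ sphere (0 : ℂ) 1, ∃ k < n, f (ω ^ k * ζ) = 0 := by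
    intro ζ hζ
    obtain ⟨j, hj⟩ := exists_int_add_mul_mem_Ioo hs0 hs2 (arg ζ)
    have hnz : (n : ℤ) ≠ 0 := by exact_mod_cast hn0.ne'
    have h2 : 0 ≤ j % n := Int.emod_nonneg _ hnz
    set m : ℕ := (j % n).toNat with hm
    set q : ℤ := j / n with hq
    have hmj : (m : ℤ) + n * q = j := by
      rw [hm, Int.toNat_of_nonneg h2]; exact Int.emod_add_mul_ediv j n
    refine ⟨m, ?_, ?_⟩
    · have h1 : (j % n : ℤ) < n := Int.emod_lt_of_pos _ (by exact_mod_cast hn0)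
      omega
    · have hjR : (j : ℝ) = (m : ℝ) + (n : ℝ) * (q : ℝ) := by exact_mod_cast hmj.symm
      have hrot : ω ^ m * ζ = exp (((arg ζ + s * j : ℝ)) * I) := by
        have harg : ((arg ζ + s * j : ℝ) : ℂ) * I
            = (arg ζ : ℂ) * I + (m : ℂ) * ((s : ℂ) * I) + (q : ℂ) * (2 * π * I) := by
          rw [hjR]
          have hsn' : (s : ℂ) * (n : ℂ) = 2 * π := by exact_mod_cast hsn
          push_cast
          linear_combination (q : ℂ) * I * hsn'
        rw [harg, exp_add, exp_add, exp_int_mul_two_pi_mul_I, mul_one, exp_nat_mul,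
          exp_arg_mul_I_of_mem_sphere hζ, mul_comm]
      rw [hrot]
      apply harc
      obtain ⟨hlo, hhi⟩ := hj
      rw [abs_sub_lt_iff]; constructor <;> linarith
  -- the product `F z = ∏_{k < n} f (ω ^ k z)` vanishes on the circle, hence on the closed disc
  set F : ℂ → ℂ := fun z ↦ ∏ k ∈ Finset.range n, f (ω ^ k * z) with hF
  have hmaps : ∀ k : ℕ, MapsTo (fun z : ℂ ↦ ω ^ k * z) (ball 0 1) (ball 0 1) := fun k z hz ↦ by
    simpa [mem_ball_zero_iff, norm_mul, hωk_norm k] using hz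
  have hmaps' : ∀ k : ℕ, MapsTo (fun z : ℂ ↦ ω ^ k * z) (closedBall 0 1) (closedBall 0 1) :=
    fun k z hz ↦ by simpa [mem_closedBall_zero_iff, norm_mul, hωk_norm k] using hz
  have hFd : DiffContOnCl ℂ F (ball 0 1) := by
    refine ⟨?_, ?_⟩
    · exact DifferentiableOn.fun_finsetProd fun k _ ↦
        hf.differentiableOn.comp ((differentiableOn_id).const_mul _) (hmaps k)
    · rw [closure_ball (0 : ℂ) one_ne_zero]
      refine continuousOn_finsetProd _ fun k _ ↦ ?_
      have hc : ContinuousOn f (closedBall (0 : ℂ) 1) := by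
        simpa [closure_ball (0 : ℂ) one_ne_zero] using hf.continuousOn
      exact hc.comp (continuousOn_id.const_smul (ω ^ k)) (hmaps' k)
  have hF0 : ∀ z ∈ closedBall (0 : ℂ) 1, F z = 0 := by
    intro z hz
    have hfr : ∀ w ∈ frontier (ball (0 : ℂ) 1), ‖F w‖ ≤ 0 := by
      intro w hw
      rw [frontier_ball (0 : ℂ) one_ne_zero] at hw
      obtain ⟨k, hk, hk0⟩ := hcover w hw
      have : F w = 0 := Finset.prod_eq_zero (Finset.mem_range.2 hk) hk0
      rw [this, norm_zero]
    have := norm_le_of_forall_mem_frontier_norm_le isBounded_ball hFd hfr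
      (by rwa [closure_ball (0 : ℂ) one_ne_zero])
    exact norm_le_zero_iff.1 this
  -- `f` is analytic in the disc; one factor vanishes near `0`, so `f ≡ 0` on the disc
  have hanal : AnalyticOnNhd ℂ f (ball 0 1) := hf.differentiableOn.analyticOnNhd isOpen_ball
  have hgan : ∀ k : ℕ, AnalyticAt ℂ (fun z ↦ f (ω ^ k * z)) 0 := fun k ↦ by
    have h0 : ω ^ k * 0 ∈ ball (0 : ℂ) 1 := by simp
    exact (hanal _ h0).comp (analyticAt_const.mul analyticAt_id)
  have hball_ev : ∀ᶠ z in 𝓝[≠] (0 : ℂ), z ∈ ball (0 : ℂ) 1 :=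
    mem_nhdsWithin_of_mem_nhds (ball_mem_nhds 0 one_pos)
  have hzero : EqOn f 0 (ball (0 : ℂ) 1) := by
    by_cases hex : ∃ k < n, ∀ᶠ z in 𝓝 (0 : ℂ), f (ω ^ k * z) = 0
    · obtain ⟨k, -, hk⟩ := hex
      have hcont : Tendsto (fun w : ℂ ↦ (ω ^ k)⁻¹ * w) (𝓝 0) (𝓝 0) := by
        have hc : Continuous fun w : ℂ ↦ (ω ^ k)⁻¹ * w := continuous_const.mul continuous_id
        simpa using hc.tendsto (0 : ℂ)
      have hev : f =ᶠ[𝓝 (0 : ℂ)] 0 := by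
        filter_upwards [hcont.eventually hk] with w hw
        simpa [mul_inv_cancel_left₀ (hωk_ne k)] using hw
      exact hanal.eqOn_zero_of_preconnected_of_eventuallyEq_zero
        (convex_ball (0 : ℂ) 1).isPreconnected (mem_ball_self one_pos) hev
    · have hne0 : ∀ k ∈ Finset.range n, ∀ᶠ z in 𝓝[≠] (0 : ℂ), f (ω ^ k * z) ≠ 0 := by
        intro k hk
        exact ((hgan k).eventually_eq_zero_or_eventually_ne_zero).resolve_left
          fun h ↦ hex ⟨k, Finset.mem_range.1 hk, h⟩
      have hall : ∀ᶠ z in 𝓝[≠] (0 : ℂ), ∀ k ∈ Finset.range n, f (ω ^ k * z) ≠ 0 :=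
        (Finset.eventually_all _).2 hne0
      obtain ⟨z, hz1, hz2⟩ := (hall.and hball_ev).exists
      exact absurd (hF0 z (ball_subset_closedBall hz2)) (Finset.prod_ne_zero_iff.2 hz1)
  -- and on the closed disc by continuity
  have hc : ContinuousOn f (closedBall (0 : ℂ) 1) := by
    simpa [closure_ball (0 : ℂ) one_ne_zero] using hf.continuousOn
  exact hzero.of_subset_closure hc continuousOn_const ball_subset_closedBall
    (by rw [closure_ball (0 : ℂ) one_ne_zero])

end Complex
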